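import Summits.QuantumFields.YangMills.Theorems.BalabanUVNodesN11RestrictedAveragingReverseAC
import Summits.QuantumFields.YangMills.Theorems.BalabanUVNodesN11K1SupportsOmegaTopGaussianDial
import Summits.QuantumFields.YangMills.Theorems.BalabanUVNodesN11BackgroundCoPMeasurable

/-!
# DAG node N11 ∕ key K1⁹ — THE OFF-TOP GAUSSIAN-BARE SUPPORT INCLUSION AT THE FIRST RG STEP IS A THEOREM, NO ROW LEFT
# (the `k = 0` clause of the located sentence's last N11-side hypothesis `hsupp` of ✓p735871; count-neutral, LOCATED)

HEADER — WORK-UNIT METADATA.  Cell `pub-ymgap`, YM-PLAN Track A (HUMAN RULING D-0062), seat `pub-ymgap-dag-n11-d` (g37; N11 [B14], s2), route `BalabanUVNodes`, item K1⁹ =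
stmt-QuantumFields-27364 (helper lane, `--kind proof --supports 27364 --as helper`, count-neutral).  [III] = [Balaban1988Convergent], [I] = [Balaban1987RG1].
CONSUMED BY NAME, nothing modified: this seat's O1 `…N11RestrictedAveragingReverseAC` (REVERSE Haar-a.c. of 11a's restricted averaging; kernel-transport positivity), K ✓p735295
(§0 bookkeeping), g6 `Node00.TkFirstStepRegionVanishing`, g3 `Node00.TkNoExpansionStepZero` (`pairCfg`), `…N11BackgroundCoPMeasurable` (`measurable_UbgOfRecord₁₃CoP`), w1∕w4's
`…N11AFibreDominationOfCoercive` (Gaussian majorant), g9 `…N11TkOpMeasurable` (`measurable_chiAW`), def-T's 11a `Node00.TkOfRecord` ∕ 11c `Node00.Sect2FormOfRecord`, r11's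
`B14.Eq225Concrete.wilsonLocal_add_E225`, `Missing.measurable_wilsonAction4`, `wilsonAction4_nonneg`.

WHY (index `N11-G36-FLAG15-CERT-5.md` § «what is left»; O1's header).  The located sentence for K1⁹ v10 ends in ONE R-level V-transport hypothesis per child `s` with `Ω_{k+1}(s) ≠ 𝕋`
(L ✓p735871, binder `hsupp`): «a.e. on the `χ_{k+1}(s)`-support, `0 < ρ_{k+1}(s)(V) → 0 < I^G_P(s)(V)`», `I^G_P(s)` = 11a's `𝐓_{k+1}(s)` with the Gaussian-bare weights `⟨1, Σ‖A‖², χ_A⟩` on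
the zero-term operand.  g36 reduced it per generation to (R1) reverse Haar-a.c. of the restricted averaging + (R2) def-T's operand rows + (R3) Fubini across nested generations; O1 made
(R1) a theorem.  THIS FILE settles the FIRST GENERATION COMPLETELY: at `k = 0` the clause holds for EVERY new sequence of length `1`, with (R2) DISCHARGED (the zero-term (2.23) action
is `−(1∕g₀²)A(U) − E₁`; def-R's background map is measurable) and (R3) void.  What remains of `hsupp` is its `k ≥ 1` part (the same ingredients threaded through the nested
generations: the inner branch value is positive only a.e. in the scale-`k` variables and the outer conditional law must be shown to charge that set — not typed here).

WHAT THIS FILE PROVES (theorems only; 0 `def`, 0 `sorry`, standard axioms).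
§1 `gaussBare_laws` (11a's weight laws for `⟨1, Σ‖A‖², χ_A⟩`) · `w_gaussBare_empty_update_eq` (the ∅-branch A-weight at an A-updated configuration with vanishing scale-`k` fluctuation
   variables reads ONLY the inserted variables: `χ^{(k)}(cubes ⊂ Y)(0[sA:=a])·e^{−½Σ‖(0[sA:=a]) b‖²}`) · ★ `integral_afibre_gaussBare_empty_pos` (θ-FREE twin of K's `integral_afibre_emptyBranch_pos`:
   `c₀ := ∫ χ^{(k)}(0[sA:=a]) e^{−½Σ_{b∈sA}‖a b‖²} da > 0` for `δ_k > 0` — Gaussian-integrable, `= e^{−½‖a‖²}` on the (3.16) ball).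
§2 `genOp_zero_baseCfg_eq_kernelRT` (ONE branch `𝐓^{(0)}(s′,S)` read at `base V₁` IS 11a's restricted kernel transport of `ζ_0(Ω₁ᶜ)·(A-factor)` at the two-scale configurations
   `(1[sV:=y], V₁)`, evaluated at `V₁|_{sV′}`) · `measurable_pairCfg_fst_updateFinset` · ★★★ `sect2Slot_gaussBare_one_pos_ae` (generic numerics `ν, A₁, M, g`, any setting ∕ residual
   recipes ∕ constant ∕ background map, `N ≥ 2`, `δ_0 > 0`, ANY new sequence of length 1, DISPLAYED operand rows `hΦm`∕`hΦb`): `0 < sect2Slot … ⟨1,Σ‖A‖²,χ_A⟩ s 0 E′ U (V₁)` for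
   `dV₁`-a.e. `V₁`.  MECHANISM: the slot is the sum over the `{S_j}`-index of nonnegative branch values (weight laws) `≥` its `S ≡ ∅` summand `=` the restricted kernel transport of
   `y ↦ 1·c₀·e^{A_1}(U(1[sV:=y], V₁))` (`aOp_of_indep`: with zero terms the operand does not read the inserted fluctuation variables; §1) — a positive BOUNDED MEASURABLE integrand, so the
   transport is positive wherever the marginal density at `V₁|_{sV′}` is (O1 §1), i.e. `dV₁`-a.e. by O1's REVERSE a.c. pulled back along the measure-preserving restriction.
§3 `action23_zero_eq` ((2.23) with zero term values IS `−(1∕g₀²)A(U) − E_k`) · `action23_zero_le` · ★ `sect2Operand_zero_le` (row `hΦb` DISCHARGED: the zero-term operand is `≤ e^{−E_k}`,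
   from `reTr ≤ 1` alone) · ★ `measurable_sect2Operand_zero` (row `hΦm` ⟸ measurability of the background map) · ★★★ `sect2Slot_gaussBare_one_pos_ae_of_measurable_bg`.
§4 ★★★★ `offTop_gaussSupports_firstStep` — AT THE RECORD (`θ : Stage13HParams`, run `P`, constants `e`, `N ≥ 2`, `δ_0 > 0`): the `k = 0` instance of L's `hsupp`, VERBATIM in its binder
   shape (`chiSeqOfRecord … ≠ 0 → 0 < slotsOfRecord … → 0 < sect2Slot …`), for EVERY `s` — NO HYPOTHESIS LEFT (background-map measurability by `measurable_UbgOfRecord₁₃CoP`).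

KERNEL NOTE (for successors).  O1's import cone brings the tree's GLOBAL instance `B6Prop26ReachTransplant.instDecidableEqPBond` into scope, while 11a's branch operators
(`tkBranchOfRecord`, `genDataOfRecord` under `open Classical`) carry the CLASSICAL instance `fun a b => Classical.propDecidable (a = b)`: any `genDataOfRecord … j` elaborated here with
the global instance is NOT definitionally the one inside `TkOfRecord_apply`'s unfolding, and unification then TIMES OUT at `whnf` instead of failing.  The proofs pin
`letI hdec : ∀ j, DecidableEq (PBond (F.P p.K) j) := fun j a b => Classical.propDecidable (a = b)` first and pass `(hdec := hdec 0)` to the `{hdec}`-implicit lemmas.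

HONEST FRAMING.  Count-neutral LOCATED instrument: [folklore] measure theory + kernel bookkeeping over accepted declarations; nothing of Bałaban's estimates ([I] §2, [III] §3
(3.10)–(3.25)) asserted or refuted; the Gaussian-bare weights are the FIAT residual of FLAG №15 (not print's `Δ^{(j)}`, which the tree does not construct); the statement is about the
a.e.-VERSION of record of 11a's kernel transport; the `k ≥ 1` part of `hsupp`, `Cor3_250`, the window and the run rows remain HYPOTHESES of L's consequent theorem — NO K1⁹ witness
is produced; N11 NOT discharged; K1⁹ NOT closed; no registered stub touched; counts unmoved (typed 28∕28 · discharged 8∕27 = 8∕28 incl. NODE O).  One finite four-torus programme at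
fixed `ε = L^{−K}`; R4 = the conditional finite-𝕋⁴ rung `BalabanLadder.UV` only; NOT ℝ⁴, NOT OS, NOT a mass gap, NOT Clay.  No `sorry`, `axiom`, `def`, `instance`, `notation`.
Sources (locators): [III] Thm 1 p.262, (2.1) p.254, (2.12)–(2.13) pp.256–257, (2.17)–(2.18) p.257, (2.20)–(2.25) pp.258–259, (3.4) p.265, (3.16) p.268, (3.21) p.269, (3.23)–(3.25) p.270;
[I] (0.2) p.252, (0.4) p.253, (2.11) p.267 (shape of the Gaussian A-weight); [Balaban1989LargeFieldII] Thm 1 p.355 (K1⁹'s (B)-face, bookkeeping).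
-/

noncomputable section

open MeasureTheory Function
open scoped BigOperators Matrix.Norms.L2Operator ENNReal NNReal

namespace Summit.QuantumFields.YangMills.Theorems.BalabanUVNodesN11K1SupportsOffTopFirstStep

open Literature.MathematicalPhysics.QuantumFieldTheory.Balaban1983to89 T4Continuum
open T4AdjointCovariance (insA JCfg)
open Node00 Node00.Tk B14.Eq218Concrete
open B10Eq42TorusConstraint (bondsIn mem_bondsIn_iff)
open B14.Eq316 (SmallFluct)
open BalabanUVNodesN11K1SupportsOmegaTopGaussianDial (chiAW_empty_eq_chiSmallAW' sect2Operand_zero_congr_fluct sect2Operand_zero_update_eq)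
open BalabanUVNodesN11AFibreDominationOfCoercive (lintegral_gaussMajorant_ne_top exp_neg_half_le_gaussMajorant)
open BalabanUVNodesN11TkOpMeasurable (measurable_chiAW)
open BalabanUVNodesN11RestrictedAveragingReverseAC (kernelRT_pos_of_margDensity_pos margDensity_pos_ae_of_reverseAC
  pi_absolutelyContinuous_map_avgRestrOfRecord_genData pi_absolutelyContinuous_map_avgRestrOfRecord_genData_of_two_le haar_setOf_delta_le_dist1_ne_zero)

variable {F : T4Family} {N : ℕ} [NeZero N]

/-! ## §1  The Gaussian-bare weights: laws; the empty-branch A-weight reads the generation's fluctuation variables only; its fibre integral is a positive constant -/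

section Weights

variable (ν : Stage7Numerics) (A₁ : ℝ) (p : B12.RunParams) (g : ℕ → ℝ) (Ω : ℕ → Set (Site (F.P p.K) 0))

/-- **THE GAUSSIAN-BARE 𝐓-WEIGHTS OBEY 11a's WEIGHT LAWS** (`ζ ≡ 1 ≥ 0`, `0 ≤ χ_A ≤ 1`). [cite: Balaban1988Convergent, (2.21) p.258, (3.21) p.269 (bookkeeping)] -/
theorem gaussBare_laws :
    (⟨fun _ _ _ => 1, fun j Λ' ω => ∑ b ∈ (Set.toFinite (bondsIn j (Λ'ᶜ ∩ Ω (j + 1)))).toFinset, ‖(ω j).2 b‖ ^ 2,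
        chiAW F N (FluctV N) ν A₁ p g⟩ : TkWeights F N (FluctV N) p.K).Laws where
  zeta_nonneg := fun _ _ _ => zero_le_one
  chiA_nonneg := fun j Y S ω => chiAW_nonneg j Y S ω
  chiA_le_one := fun j Y S ω => chiAW_le_one j Y S ω

/-- **THE EMPTY-BRANCH A-WEIGHT AT AN A-UPDATED CONFIGURATION WITH VANISHING SCALE-`k` FLUCTUATION VARIABLES READS ONLY THE INSERTED VARIABLES**:
`w_k(Λ′, Y, ∅)(ω[A_k|_{sA} := a]) = χ^{(k)}(cubes ⊂ Y)(0[sA := a]) · e^{−½ Σ_{b∈sA} ‖(0[sA := a])(b)‖²}` — independent of `ω`. [cite: Balaban1988Convergent, (2.21) p.258, (3.16) p.268, (3.21) p.269 (bookkeeping)] -/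
theorem w_gaussBare_empty_update_eq (k : ℕ) (Λ' Y : Set (Site (F.P p.K) 0)) {hdec : DecidableEq (PBond (F.P p.K) k)} (sA : Finset (PBond (F.P p.K) k))
    (ω : MultiCfg (F.P p.K) (SU N) (FluctV N)) (hω : (ω k).2 = 0) (a : ↥sA → FluctV N) :
    (⟨fun _ _ _ => 1, fun j Λ' ω => ∑ b ∈ (Set.toFinite (bondsIn j (Λ'ᶜ ∩ Ω (j + 1)))).toFinset, ‖(ω j).2 b‖ ^ 2,
        chiAW F N (FluctV N) ν A₁ p g⟩ : TkWeights F N (FluctV N) p.K).w k Λ' Y ∅ (Function.update ω k (insA sA a (ω k))) =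
      B14.Eq316.chiK (bondsStarW F ν p g k) (Function.updateFinset (0 : VecField (F.P p.K) k (FluctV N)) sA a) (deltaOfRecord ν g k A₁) (cubesIn (cubeχ F ν p g k) Y) *
        Real.exp (-(1 / 2 : ℝ) * ∑ b ∈ (Set.toFinite (bondsIn k (Λ'ᶜ ∩ Ω (k + 1)))).toFinset, ‖(Function.updateFinset (0 : VecField (F.P p.K) k (FluctV N)) sA a) b‖ ^ 2) := by
  have h2 : ((Function.update ω k (insA sA a (ω k))) k).2 = Function.updateFinset (0 : VecField (F.P p.K) k (FluctV N)) sA a := by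
    rw [Function.update_self, ← hω]
    rfl
  show chiAW F N (FluctV N) ν A₁ p g k Y ∅ _ * Real.exp (-(1 / 2 : ℝ) * ∑ b ∈ _, ‖((Function.update ω k (insA sA a (ω k))) k).2 b‖ ^ 2) = _
  rw [chiAW_empty_eq_chiSmallAW']
  show B14.Eq316.chiK (bondsStarW F ν p g k) ((Function.update ω k (insA sA a (ω k))) k).2 (deltaOfRecord ν g k A₁) (cubesIn (cubeχ F ν p g k) Y) * _ = _
  rw [h2]

/-- **THE EMPTY-BRANCH A-FIBRE INTEGRAL IS ONE POSITIVE NUMBER** (`δ_k > 0`; `sA = B_k(Λ′ᶜ ∩ Ω_{k+1})`, `Y = Λ′ᶜ ∩ Ω_{k+1}` as in 11a's `genDataOfRecord`):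
`c₀ := ∫ χ^{(k)}(cubes ⊂ Y)(0[sA := a]) e^{−½Σ_{b∈sA}‖a b‖²} da > 0` — Gaussian-integrable, equal to the Gaussian on the (3.16) ball `{‖a‖ < δ_k}`, an open neighbourhood of `0` of
positive Lebesgue measure (the θ-free form of K's `integral_afibre_emptyBranch_pos`). [cite: Balaban1988Convergent, (2.21) p.258, (3.16) p.268, (3.21) p.269, (3.4) p.265; Balaban1987RG1, (2.11) p.267 (shape only)] -/
theorem integral_afibre_gaussBare_empty_pos (k : ℕ) (Λ' : Set (Site (F.P p.K) 0)) (hδ : 0 < deltaOfRecord ν g k A₁) {hdec : DecidableEq (PBond (F.P p.K) k)} :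
    0 < ∫ a : ↥(Set.toFinite (bondsIn k (Λ'ᶜ ∩ Ω (k + 1)))).toFinset → FluctV N,
        B14.Eq316.chiK (bondsStarW F ν p g k) (Function.updateFinset (0 : VecField (F.P p.K) k (FluctV N)) (Set.toFinite (bondsIn k (Λ'ᶜ ∩ Ω (k + 1)))).toFinset a)
            (deltaOfRecord ν g k A₁) (cubesIn (cubeχ F ν p g k) (Λ'ᶜ ∩ Ω (k + 1))) *
          Real.exp (-(1 / 2 : ℝ) * ∑ b ∈ (Set.toFinite (bondsIn k (Λ'ᶜ ∩ Ω (k + 1)))).toFinset,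
            ‖(Function.updateFinset (0 : VecField (F.P p.K) k (FluctV N)) (Set.toFinite (bondsIn k (Λ'ᶜ ∩ Ω (k + 1)))).toFinset a) b‖ ^ 2)
      ∂(Measure.pi fun _ => (volume : Measure (FluctV N))) := by
  set sA : Finset (PBond (F.P p.K) k) := (Set.toFinite (bondsIn k (Λ'ᶜ ∩ Ω (k + 1)))).toFinset with hsA
  set ω₀ : MultiCfg (F.P p.K) (SU N) (FluctV N) := fun _ => (fun _ => 1, fun _ => 0) with hω₀
  set W : TkWeights F N (FluctV N) p.K := ⟨fun _ _ _ => 1, fun j Λ' ω => ∑ b ∈ (Set.toFinite (bondsIn j (Λ'ᶜ ∩ Ω (j + 1)))).toFinset, ‖(ω j).2 b‖ ^ 2,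
    chiAW F N (FluctV N) ν A₁ p g⟩ with hW
  set upd : (↥sA → FluctV N) → MultiCfg (F.P p.K) (SU N) (FluctV N) := fun a => Function.update ω₀ k (insA sA a (ω₀ k)) with hupd
  have hω₀ : (ω₀ k).2 = 0 := rfl
  have hint_eq : ∀ a, B14.Eq316.chiK (bondsStarW F ν p g k) (Function.updateFinset (0 : VecField (F.P p.K) k (FluctV N)) sA a) (deltaOfRecord ν g k A₁)
        (cubesIn (cubeχ F ν p g k) (Λ'ᶜ ∩ Ω (k + 1))) *
      Real.exp (-(1 / 2 : ℝ) * ∑ b ∈ sA, ‖(Function.updateFinset (0 : VecField (F.P p.K) k (FluctV N)) sA a) b‖ ^ 2) =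
      W.w k Λ' (Λ'ᶜ ∩ Ω (k + 1)) ∅ (upd a) := fun a => (w_gaussBare_empty_update_eq ν A₁ p g Ω k Λ' (Λ'ᶜ ∩ Ω (k + 1)) sA ω₀ hω₀ a).symm
  simp_rw [hint_eq]
  have hval : ∀ a (b : PBond (F.P p.K) k), (upd a k).2 b = if hb : b ∈ sA then a ⟨b, hb⟩ else 0 := fun a b => by
    simp only [hupd, Function.update_self]
    show Function.updateFinset (ω₀ k).2 sA a b = _
    simp only [Function.updateFinset_def]
    split_ifs <;> rfl
  have hquad : ∀ a, W.quad k Λ' (upd a) = ∑ b : ↥sA, ‖a b‖ ^ 2 := fun a => by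
    show ∑ b ∈ (Set.toFinite (bondsIn k (Λ'ᶜ ∩ Ω (k + 1)))).toFinset, ‖(upd a k).2 b‖ ^ 2 = _
    rw [← hsA, ← Finset.sum_coe_sort sA]
    refine Finset.sum_congr rfl fun b _ => ?_
    rw [hval, dif_pos b.2]
  have hw : ∀ a, W.w k Λ' (Λ'ᶜ ∩ Ω (k + 1)) ∅ (upd a) =
      chiAW F N (FluctV N) ν A₁ p g k (Λ'ᶜ ∩ Ω (k + 1)) ∅ (upd a) * Real.exp (-(1 / 2 : ℝ) * ∑ b : ↥sA, ‖a b‖ ^ 2) := fun a => by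
    show chiAW F N (FluctV N) ν A₁ p g k (Λ'ᶜ ∩ Ω (k + 1)) ∅ (upd a) * Real.exp (-(1 / 2 : ℝ) * W.quad k Λ' (upd a)) = _
    rw [hquad]
  have hmu : Measurable upd := (measurable_update ω₀).comp (measurable_const.prodMk measurable_updateFinset)
  have hq : Measurable (W.quad k Λ') := by
    refine Finset.measurable_sum _ fun b _ => ?_
    have hb : Measurable fun ω : MultiCfg (F.P p.K) (SU N) (FluctV N) => (ω k).2 b :=
      (measurable_pi_apply b).comp (measurable_snd.comp (measurable_pi_apply k))
    exact (hb.norm).pow_const 2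
  have hmeas : Measurable fun a => W.w k Λ' (Λ'ᶜ ∩ Ω (k + 1)) ∅ (upd a) :=
    ((measurable_chiAW F N (FluctV N) ν A₁ p g k (Λ'ᶜ ∩ Ω (k + 1)) ∅).mul (Real.measurable_exp.comp (measurable_const.mul hq))).comp hmu
  have hnn : ∀ a, 0 ≤ W.w k Λ' (Λ'ᶜ ∩ Ω (k + 1)) ∅ (upd a) := fun a => mul_nonneg (chiAW_nonneg _ _ _ _) (Real.exp_nonneg _)
  have hle : ∀ a, W.w k Λ' (Λ'ᶜ ∩ Ω (k + 1)) ∅ (upd a) ≤ ∏ b : ↥sA, Real.exp (-(1 * ‖a b‖ ^ 2) / 2) := fun a => by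
    rw [hw]
    calc chiAW F N (FluctV N) ν A₁ p g k (Λ'ᶜ ∩ Ω (k + 1)) ∅ (upd a) * Real.exp (-(1 / 2 : ℝ) * ∑ b : ↥sA, ‖a b‖ ^ 2)
        ≤ Real.exp (-(1 / 2 : ℝ) * ∑ b : ↥sA, ‖a b‖ ^ 2) := mul_le_of_le_one_left (Real.exp_nonneg _) (chiAW_le_one _ _ _ _)
      _ ≤ ∏ b : ↥sA, Real.exp (-(1 * ‖a b‖ ^ 2) / 2) := exp_neg_half_le_gaussMajorant Finset.univ a (by rw [one_mul])
  have hint_gauss : Integrable (fun a : ↥sA → FluctV N => ∏ b : ↥sA, Real.exp (-(1 * ‖a b‖ ^ 2) / 2)) (Measure.pi fun _ => (volume : Measure (FluctV N))) := by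
    have hm : Measurable fun a : ↥sA → FluctV N => ∏ b : ↥sA, Real.exp (-(1 * ‖a b‖ ^ 2) / 2) :=
      Finset.measurable_prod _ fun b _ => Real.measurable_exp.comp (((measurable_const.mul ((measurable_pi_apply b).norm.pow_const 2)).neg).div_const 2)
    refine ⟨hm.aestronglyMeasurable, (hasFiniteIntegral_iff_ofReal (Filter.Eventually.of_forall fun a => ?_)).2 ?_⟩
    · exact Finset.prod_nonneg fun b _ => (Real.exp_pos _).le
    · have e : (fun a : ↥sA → FluctV N => ENNReal.ofReal (∏ b : ↥sA, Real.exp (-(1 * ‖a b‖ ^ 2) / 2))) =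
          fun a => ∏ b : ↥sA, ENNReal.ofReal (Real.exp (-(1 * ‖a b‖ ^ 2) / 2)) :=
        funext fun a => ENNReal.ofReal_prod_of_nonneg fun b _ => (Real.exp_pos _).le
      rw [e]
      exact (lintegral_gaussMajorant_ne_top (ι := ↥sA) (κ := Fin (N ^ 2 - 1)) one_pos).lt_top
  have hint : Integrable (fun a => W.w k Λ' (Λ'ᶜ ∩ Ω (k + 1)) ∅ (upd a)) (Measure.pi fun _ => (volume : Measure (FluctV N))) :=
    hint_gauss.mono' hmeas.aestronglyMeasurable (Filter.Eventually.of_forall fun a => by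
      rw [Real.norm_eq_abs, abs_of_nonneg (hnn a)]; exact hle a)
  have hbox : Metric.ball (0 : ↥sA → FluctV N) (deltaOfRecord ν g k A₁) ⊆ Function.support fun a => W.w k Λ' (Λ'ᶜ ∩ Ω (k + 1)) ∅ (upd a) := by
    intro a ha
    rw [mem_ball_zero_iff, pi_norm_lt_iff hδ] at ha
    have hsmall : ∀ b : PBond (F.P p.K) k, ‖(upd a k).2 b‖ < deltaOfRecord ν g k A₁ := fun b => by
      rw [hval]
      split_ifs with hb
      · exact ha ⟨b, hb⟩
      · rwa [norm_zero]
    have hχ : chiAW F N (FluctV N) ν A₁ p g k (Λ'ᶜ ∩ Ω (k + 1)) ∅ (upd a) = 1 := by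
      classical
      rw [chiAW_empty_eq_chiSmallAW', chiSmallAW_eq_ite]
      exact if_pos fun c _ b _ => hsmall b
    rw [Function.mem_support, hw, hχ, one_mul]
    exact (Real.exp_pos _).ne'
  have hvol : 0 < (Measure.pi fun _ : ↥sA => (volume : Measure (FluctV N))) (Function.support fun a => W.w k Λ' (Λ'ᶜ ∩ Ω (k + 1)) ∅ (upd a)) :=
    lt_of_lt_of_le (Metric.isOpen_ball.measure_pos _ ⟨0, Metric.mem_ball_self hδ⟩) (measure_mono hbox)
  exact (integral_pos_iff_support_of_nonneg hnn hint).2 hvol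

end Weights

/-! ## §2  11a's FIRST 𝐓-STEP at ANY new sequence: the empty-branch summand is ONE restricted kernel transport of `ζ_0·(A-factor)` read at `V₁|_{sV′}`; with the
Gaussian-bare weights and a fluctuation-blind positive bounded measurable operand it is `dV₁`-a.e. POSITIVE (reverse a.c. of O1 + §1), and so is the whole slot -/

section FirstStep

variable {V : Type} [NormedAddCommGroup V] [InnerProductSpace ℝ V] [FiniteDimensional ℝ V] [MeasurableSpace V] [BorelSpace V]
variable (ν : Stage7Numerics) (M : ℕ) (g : ℕ → ℝ) (K : ℕ)

/-- **ONE BRANCH `𝐓^{(0)}(s′, S)` READ AT `base V₁` IS THE RESTRICTED KERNEL TRANSPORT (2.21) OF `ζ_0(Ω₁ᶜ)·(A-factor)` AT THE TWO-SCALE CONFIGURATIONS `(1[sV := y], V₁)`,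
EVALUATED AT `V₁|_{sV′}`** (11a's `genOp_apply` ∕ `vOp_apply` ∕ `zetaOp_apply`, this seat's `update_baseCfg_one_eq_pairCfg` ∕ `baseCfg_fst_self`).
[cite: Balaban1988Convergent, (2.20)–(2.22) p.258 (bookkeeping)] -/
theorem genOp_zero_baseCfg_eq_kernelRT (W : TkWeights F N V K) (s : SeqOfRecord F ν M g K 1) (S : ℕ → Set (Site (F.P K) 0))
    {hdec : DecidableEq (PBond (F.P K) 0)} (Φ' : MultiCfg (F.P K) (SU N) V → ℝ) (V1 : GaugeField (F.P K) 1 (SU N)) :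
    genOp 0 (genDataOfRecord F N V ν M g K W s S 0) Φ' (baseCfg 1 V1) =
      kernelRT (avgRestrOfRecord F N K 0 (genDataOfRecord F N V ν M g K W s S 0).sV (genDataOfRecord F N V ν M g K W s S 0).sV')
        (fun y => (genDataOfRecord F N V ν M g K W s S 0).ζ (pairCfg V1 (Function.updateFinset (fun _ => 1) (genDataOfRecord F N V ν M g K W s S 0).sV y)) *
          aOp 0 (genDataOfRecord F N V ν M g K W s S 0).sA (genDataOfRecord F N V ν M g K W s S 0).w Φ'
            (pairCfg V1 (Function.updateFinset (fun _ => 1) (genDataOfRecord F N V ν M g K W s S 0).sV y)))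
        (fun b => V1 b) := by
  rw [genOp_apply, vOp_apply]
  exact congrArg₂ (genDataOfRecord F N V ν M g K W s S 0).vT
    (funext fun y => by
      show zetaOp _ _ _ = _
      rw [zetaOp_apply, update_baseCfg_one_eq_pairCfg])
    (funext fun b => baseCfg_fst_self (V := V) 1 V1 b)

omit [NeZero N] [InnerProductSpace ℝ V] [FiniteDimensional ℝ V] [MeasurableSpace V] [BorelSpace V] in
/-- The gauge components of the two-scale configuration `(1[sV := y], V₁)` depend measurably on `y`. [cite: Balaban1988Convergent, (2.21) p.258 (bookkeeping)] -/
theorem measurable_pairCfg_fst_updateFinset [DecidableEq (PBond (F.P K) 0)] (sV : Finset (PBond (F.P K) 0)) (V1 : GaugeField (F.P K) 1 (SU N)) :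
    Measurable fun (y : ↥sV → SU N) => fun j => (pairCfg (V := V) V1 (Function.updateFinset (fun _ => (1 : SU N)) sV y) j).1 := by
  refine measurable_pi_lambda _ fun j => ?_
  by_cases hj : j = 0
  · subst hj
    simp only [pairCfg_zero]
    exact measurable_updateFinset
  · simp only [pairCfg_of_ne_zero _ _ hj]
    exact measurable_const

end FirstStep

section FirstStepOfRecord

variable (ν : Stage7Numerics) (A₁ : ℝ) (M : ℕ) (p : B12.RunParams) (g : ℕ → ℝ)
variable {𝔸 : Type*} [NormedRing 𝔸] [NormedAlgebra ℂ 𝔸] [CompleteSpace 𝔸]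

open Classical in
/-- ★★★ **AT THE FIRST RG STEP THE GAUSSIAN-BARE §2-FORM SLOT OF EVERY NEW SEQUENCE IS `dV₁`-a.e. STRICTLY POSITIVE, MODULO def-T's OPERAND ROWS** (`N ≥ 2`, `δ_0 > 0`; ANY
`s′` of length `1`; any setting ∕ residual recipes ∕ constant ∕ background map; ZERO terms; DISPLAYED `hΦm`∕`hΦb` = measurability ∕ an upper bound of `W ↦ e^{A_1(s′;0,E′)}(U W)`, both
discharged in §3): the slot `≥` its `S ≡ ∅` summand `=` the restricted kernel transport of the positive bounded measurable `y ↦ c₀·e^{A_1}(U(1[sV:=y],V₁))`, positive wherever the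
marginal density at `V₁|_{sV′}` is (O1), i.e. `dV₁`-a.e. by O1's reverse a.c. [cite: Balaban1988Convergent, (2.18) p.257, (2.20)–(2.23) p.258, (3.16) p.268, (3.21) p.269, (3.23)–(3.24) p.270, (3.4) p.265; Balaban1987RG1, (0.4) p.253] -/
theorem sect2Slot_gaussBare_one_pos_ae (hN : 2 ≤ N) (Sg : Sect2.Setting 𝔸 (SU N)) (Rz : Sect2.Residual (F.P p.K) 𝔸) (s : SeqOfRecord F ν M g p.K 1)
    (hδ : 0 < deltaOfRecord ν g 0 A₁) (E' : ℝ) (U : BgMap F N p.K)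
    (hΦm : ∀ a, Measurable fun W => sect2Operand F N (FluctV N) p.K Sg Rz s (Sect2.TermValues.zero : Sect2.TermValues (F.P p.K) 𝔸 (FluctV N) M) E' U a W)
    {B : ℝ} (hΦb : ∀ a W, sect2Operand F N (FluctV N) p.K Sg Rz s (Sect2.TermValues.zero : Sect2.TermValues (F.P p.K) 𝔸 (FluctV N) M) E' U a W ≤ B) :
    ∀ᵐ V1 ∂fieldMeasure (F.P p.K) 1 (SU N),
      0 < sect2Slot F N (FluctV N) p.K Sg Rz
        (⟨fun _ _ _ => 1, fun j Λ' ω => ∑ b ∈ (Set.toFinite (bondsIn j (Λ'ᶜ ∩ s.Ω (j + 1)))).toFinset, ‖(ω j).2 b‖ ^ 2,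
          chiAW F N (FluctV N) ν A₁ p g⟩ : TkWeights F N (FluctV N) p.K) s Sect2.TermValues.zero E' U V1 := by
  letI hdec : ∀ j, DecidableEq (PBond (F.P p.K) j) := fun j a b => Classical.propDecidable (a = b)
  set W : TkWeights F N (FluctV N) p.K := ⟨fun _ _ _ => 1, fun j Λ' ω => ∑ b ∈ (Set.toFinite (bondsIn j (Λ'ᶜ ∩ s.Ω (j + 1)))).toFinset, ‖(ω j).2 b‖ ^ 2,
    chiAW F N (FluctV N) ν A₁ p g⟩ with hW
  set D := genDataOfRecord F N (FluctV N) ν M g p.K W s (fun _ => ∅) 0 with hD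
  set Φ : SFluct (F.P p.K) (FluctV N) → B15DeterminingSets.MSField (F.P p.K) (SU N) → ℝ :=
    sect2Operand F N (FluctV N) p.K Sg Rz s (Sect2.TermValues.zero : Sect2.TermValues (F.P p.K) 𝔸 (FluctV N) M) E' U with hΦ
  have hj : 0 + 1 ≤ (F.P p.K).m + (F.P p.K).K := by have := F.hm; simp only [T4Family.P_m]; omega
  have hrev := pi_absolutelyContinuous_map_avgRestrOfRecord_genData_of_two_le F N hN ν M g p.K W s (fun _ => ∅) 0 (hdec := hdec 0) hj
  have hmarg := margDensity_pos_ae_of_reverseAC _ _ (measurable_avgRestrOfRecord (F := F) (N := N) p.K 0 D.sV D.sV') hrev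
  have hr := measurePreserving_restrict_fieldMeasure (P := F.P p.K) (j := 1) (G := SU N) D.sV'
  have hmarg' : ∀ᵐ y' ∂(fieldMeasure (F.P p.K) 1 (SU N)).map (fun (V' : GaugeField (F.P p.K) 1 (SU N)) (b : ↥D.sV') => V' b),
      0 < (T4AveragingDisintegration.margDensity (Measure.pi fun _ : ↥D.sV => (HaarData.haar : Measure (SU N)))
        (Measure.pi fun _ : ↥D.sV' => (HaarData.haar : Measure (SU N))) (avgRestrOfRecord F N p.K 0 D.sV D.sV') y' : ℝ) := by
    rw [hr.map_eq]
    exact hmarg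
  filter_upwards [ae_of_ae_map hr.measurable.aemeasurable hmarg'] with V1 hV1
  have hc₀ := integral_afibre_gaussBare_empty_pos (N := N) ν A₁ p g s.Ω 0 (s.Λ 1) hδ (hdec := hdec 0)
  set c₀ := ∫ a : ↥(Set.toFinite (bondsIn 0 ((s.Λ 1)ᶜ ∩ s.Ω (0 + 1)))).toFinset → FluctV N,
        B14.Eq316.chiK (bondsStarW F ν p g 0) (Function.updateFinset (0 : VecField (F.P p.K) 0 (FluctV N)) (Set.toFinite (bondsIn 0 ((s.Λ 1)ᶜ ∩ s.Ω (0 + 1)))).toFinset a)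
            (deltaOfRecord ν g 0 A₁) (cubesIn (cubeχ F ν p g 0) ((s.Λ 1)ᶜ ∩ s.Ω (0 + 1))) *
          Real.exp (-(1 / 2 : ℝ) * ∑ b ∈ (Set.toFinite (bondsIn 0 ((s.Λ 1)ᶜ ∩ s.Ω (0 + 1)))).toFinset,
            ‖(Function.updateFinset (0 : VecField (F.P p.K) 0 (FluctV N)) (Set.toFinite (bondsIn 0 ((s.Λ 1)ᶜ ∩ s.Ω (0 + 1)))).toFinset a) b‖ ^ 2)
      ∂(Measure.pi fun _ => (volume : Measure (FluctV N))) with hc₀_def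
  show 0 < TkOfRecord F N (FluctV N) ν M g p.K W 1 s Φ V1
  rw [TkOfRecord_apply]
  have hmem : (fun _ => (∅ : Set (Site (F.P p.K) 0))) ∈ admSOfRecord F ν M g p.K 1 s :=
    const_empty_mem_admSSeq _ (empty_mem_SClassOfRecord F ν g p.K) s
  have hΦpos : ∀ a W', 0 < Φ a W' := fun a W' => sect2Operand_pos p.K Sg Rz s _ E' U a W'
  have hsum : tkBranchOfRecord F N (FluctV N) ν M g p.K W s (fun _ => ∅) 1 (fun ω => Φ (fun _ => ∅, fun j => (ω j).2) fun j => (ω j).1) (baseCfg 1 V1) ≤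
      ∑ S ∈ admSOfRecord F ν M g p.K 1 s, tkBranchOfRecord F N (FluctV N) ν M g p.K W s S 1 (fun ω => Φ (S, fun j => (ω j).2) fun j => (ω j).1) (baseCfg 1 V1) :=
    Finset.single_le_sum (f := fun S => tkBranchOfRecord F N (FluctV N) ν M g p.K W s S 1 (fun ω => Φ (S, fun j => (ω j).2) fun j => (ω j).1) (baseCfg 1 V1))
      (fun S _ => tkOp_nonneg _ (fun j _ hF' => genOp_nonneg j
        (genDataOfRecord_laws F N (FluctV N) ν M g p.K (gaussBare_laws ν A₁ p g s.Ω) s S j) hF') 1 (fun _ => (hΦpos _ _).le) _) hmem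
  refine lt_of_lt_of_le ?_ hsum
  rw [tkBranchOfRecord_succ, tkBranchOfRecord_zero, genOp_zero_baseCfg_eq_kernelRT]
  have hG : (fun y : ↥D.sV → SU N => D.ζ (pairCfg V1 (Function.updateFinset (fun _ => 1) D.sV y)) *
        aOp 0 D.sA D.w (fun ω => Φ (fun _ => ∅, fun j => (ω j).2) (fun j => (ω j).1)) (pairCfg V1 (Function.updateFinset (fun _ => 1) D.sV y))) =
      fun y => c₀ * Φ (fun _ => ∅, fun _ => 0) (fun j => (pairCfg (V := FluctV N) V1 (Function.updateFinset (fun _ => (1 : SU N)) D.sV y) j).1) := by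
    funext y
    set ω := pairCfg (V := FluctV N) V1 (Function.updateFinset (fun _ => (1 : SU N)) D.sV y) with hω
    have hζ : D.ζ ω = 1 := rfl
    have hω0 : (ω 0).2 = 0 := pairCfg_snd _ _ 0
    rw [hζ, one_mul, aOp_of_indep 0 D.sA D.w _ ω (fun a =>
      sect2Operand_zero_update_eq p.K Sg Rz s E' U (fun _ => ∅) ω 0 (insA D.sA a (ω 0)) rfl)]
    have hfl : (fun j => (ω j).2) = fun _ => (0 : VecField (F.P p.K) _ (FluctV N)) := by
      funext j; exact pairCfg_snd _ _ j
    rw [hfl]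
    congr 1
    rw [hc₀_def]
    refine integral_congr_ae (Filter.Eventually.of_forall fun a => ?_)
    exact w_gaussBare_empty_update_eq ν A₁ p g s.Ω 0 (s.Λ 1) ((s.Λ 1)ᶜ ∩ s.Ω (0 + 1)) D.sA ω hω0 a
  rw [hG]
  refine kernelRT_pos_of_margDensity_pos _ ?_ (fun y => mul_pos hc₀ (hΦpos _ _)) (B := c₀ * B)
    (fun y => mul_le_mul_of_nonneg_left (hΦb _ _) hc₀.le) hV1
  exact measurable_const.mul ((hΦm (fun _ => ∅, fun _ => 0)).comp (measurable_pairCfg_fst_updateFinset (V := FluctV N) p.K D.sV V1))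

end FirstStepOfRecord

/-! ## §3  def-T's OPERAND ROWS AT ZERO TERMS: `A_k(s;0,E_k)(U) = −(1∕g₀²)A(U) − E_k`, so the operand is bounded by `e^{−E_k}` OUTRIGHT and measurable as soon as the
background map is -/

section OperandRows

variable {P : Params} {G : Type*} [GaugeGroup G] {𝔸 : Type*} [NormedRing 𝔸] [NormedAlgebra ℂ 𝔸] [CompleteSpace 𝔸] {V : Type} {M : ℕ}

/-- **(2.23) WITH ZERO TERM VALUES IS THE BARE WILSON ACTION**: `A_k(U) = −(1∕g₀²)·A(U) − E_k` (r11's telescoping `wilsonLocal_add_E225`: the `β_j A(φ_j,U)` counterterms of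
(2.25) cancel the passage `1∕g₀² → 1∕g_k²(·)`; every `𝐄^{(j)}`, `𝐑^{(j)}`, `𝐁^{(j)}` value is `0`). [cite: Balaban1988Convergent, (2.23)–(2.25) pp.258–259, (2.30) p.260, (2.40) p.261 (bookkeeping)] -/
theorem action23_zero_eq (S : Sect2.Setting 𝔸 G) (Rz : Sect2.Residual P 𝔸) (ν : Stage7Numerics) (g : ℕ → ℝ) (Ω Λ : ℕ → Set (Site P 0)) (k : ℕ)
    (a : SFluct P V) (Ek : ℝ) (U : GaugeField P 0 G) :
    (Sect2.actionDataOfTerms S Rz ν M g Ω Λ (Sect2.TermValues.zero : Sect2.TermValues P 𝔸 V M) k a Ek).action23 k U =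
      -(1 / (S.flow.g 0) ^ 2 * wilsonAction4 U) - Ek := by
  rw [Sect2.action23_actionDataOfTerms]
  have hE := B14.Eq225Concrete.wilsonLocal_add_E225 (Sect2.towerOfTerms S Rz M Ω (Sect2.TermValues.zero : Sect2.TermValues P 𝔸 V M))
    (fun j X z => Sect2.admE P ν M g Λ j (Sect2.domSites P M j X) z) Rz.phi k U
  have hEj : ∀ j, B14.Eq225Concrete.EjSub (Sect2.towerOfTerms S Rz M Ω (Sect2.TermValues.zero : Sect2.TermValues P 𝔸 V M))
      (fun j X z => Sect2.admE P ν M g Λ j (Sect2.domSites P M j X) z) j U = 0 := fun j => by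
    simp only [B14.Eq225Concrete.EjSub, Sect2.towerOfTerms_E, Sect2.TermValues.zero, Complex.zero_re, sub_self, ite_self, Finset.sum_const_zero]
  have hR : B14.Eq225Concrete.R230 (Sect2.towerOfTerms S Rz M Ω (Sect2.TermValues.zero : Sect2.TermValues P 𝔸 V M))
      (fun j X => Sect2.admR P ν M g Λ j (Sect2.domSites P M j X)) k U = 0 := by
    simp only [B14.Eq225Concrete.R230, Sect2.towerOfTerms_R, Sect2.TermValues.zero, Complex.zero_re, sub_self, ite_self, Finset.sum_const_zero]
  have hB : B14.Eq225Concrete.B240 (Sect2.towerOfTerms S Rz M Ω (Sect2.TermValues.zero : Sect2.TermValues P 𝔸 V M))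
      (fun j X => Sect2.admB P ν M g Ω Λ j (Sect2.domSites P M j X)) a k U = 0 := by
    simp only [B14.Eq225Concrete.B240, Sect2.towerOfTerms_B, Sect2.TermValues.zero, Complex.zero_re, ite_self, Finset.sum_const_zero]
  simp only [hEj, Finset.sum_const_zero, add_zero, Sect2.towerOfTerms_flow] at hE
  rw [hR, hB, add_zero, add_zero, hE]

/-- **THE ZERO-TERM ACTION IS AT MOST `−E_k`** (`A(U) ≥ 0`: `reTr ≤ 1`; `1∕g₀² ≥ 0`). [cite: Balaban1988Convergent, (2.23) p.258; Balaban1987RG1, (0.2) p.252 (bookkeeping)] -/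
theorem action23_zero_le (S : Sect2.Setting 𝔸 G) (Rz : Sect2.Residual P 𝔸) (ν : Stage7Numerics) (g : ℕ → ℝ) (Ω Λ : ℕ → Set (Site P 0)) (k : ℕ)
    (a : SFluct P V) (Ek : ℝ) (U : GaugeField P 0 G) :
    (Sect2.actionDataOfTerms S Rz ν M g Ω Λ (Sect2.TermValues.zero : Sect2.TermValues P 𝔸 V M) k a Ek).action23 k U ≤ -Ek := by
  rw [action23_zero_eq]
  have h : 0 ≤ 1 / (S.flow.g 0) ^ 2 * wilsonAction4 U := mul_nonneg (by positivity) (wilsonAction4_nonneg U)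
  linarith

end OperandRows

section OperandRowsOfRecord

variable (p : B12.RunParams) {𝔸 : Type*} [NormedRing 𝔸] [NormedAlgebra ℂ 𝔸] [CompleteSpace 𝔸]

/-- **ROW `hΦb` DISCHARGED: 11c's ZERO-TERM OPERAND IS BOUNDED BY `e^{−E_k}`** (every history, setting, residual recipes, background map). [cite: Balaban1988Convergent, (2.18) p.257, (2.23) p.258 (bookkeeping)] -/
theorem sect2Operand_zero_le {ν : Stage7Numerics} {M : ℕ} {g : ℕ → ℝ} {k : ℕ} (Sg : Sect2.Setting 𝔸 (SU N)) (Rz : Sect2.Residual (F.P p.K) 𝔸)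
    (s : SeqOfRecord F ν M g p.K k) (E' : ℝ) (U : BgMap F N p.K) (a : SFluct (F.P p.K) (FluctV N)) (W : B15DeterminingSets.MSField (F.P p.K) (SU N)) :
    sect2Operand F N (FluctV N) p.K Sg Rz s (Sect2.TermValues.zero : Sect2.TermValues (F.P p.K) 𝔸 (FluctV N) M) E' U a W ≤ Real.exp (-E') :=
  Real.exp_le_exp.2 (action23_zero_le Sg Rz ν g s.Ω s.Λ k a E' (U W))

/-- **ROW `hΦm` REDUCED TO def-R's BACKGROUND MAP**: the zero-term operand `W ↦ e^{−(1∕g₀²)A(U W) − E_k}` is measurable as soon as `W ↦ U W` is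
(`Missing.measurable_wilsonAction4`, `reTr` measurable in a regular gauge group). [cite: Balaban1988Convergent, (2.18) p.257, (2.23) p.258 (bookkeeping)] -/
theorem measurable_sect2Operand_zero {ν : Stage7Numerics} {M : ℕ} {g : ℕ → ℝ} {k : ℕ} (Sg : Sect2.Setting 𝔸 (SU N)) (Rz : Sect2.Residual (F.P p.K) 𝔸)
    (s : SeqOfRecord F ν M g p.K k) (E' : ℝ) {U : BgMap F N p.K} (hU : Measurable U) (a : SFluct (F.P p.K) (FluctV N)) :
    Measurable fun W => sect2Operand F N (FluctV N) p.K Sg Rz s (Sect2.TermValues.zero : Sect2.TermValues (F.P p.K) 𝔸 (FluctV N) M) E' U a W := by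
  have e : (fun W => sect2Operand F N (FluctV N) p.K Sg Rz s (Sect2.TermValues.zero : Sect2.TermValues (F.P p.K) 𝔸 (FluctV N) M) E' U a W) =
      fun W => Real.exp (-(1 / (Sg.flow.g 0) ^ 2 * wilsonAction4 (U W)) - E') := by
    funext W
    exact congrArg Real.exp (action23_zero_eq Sg Rz ν g s.Ω s.Λ k a E' (U W))
  rw [e]
  exact (((measurable_const.mul ((Missing.measurable_wilsonAction4 RegularGaugeGroup.measurable_reTr).comp hU)).neg).sub measurable_const).exp

/-- ★★★ **THE FIRST-STEP GAUSSIAN-BARE SLOT IS `dV₁`-a.e. POSITIVE FOR EVERY NEW SEQUENCE, MODULO MEASURABILITY OF THE BACKGROUND MAP ONLY** (`N ≥ 2`, `δ_0 > 0`, zero terms):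
§2's theorem with `hΦb` discharged (`sect2Operand_zero_le`) and `hΦm` reduced to `Measurable U` (`measurable_sect2Operand_zero`). [cite: Balaban1988Convergent, (2.18) p.257, (2.20)–(2.23) p.258, (3.16) p.268, (3.21) p.269, (3.23)–(3.24) p.270; Balaban1987RG1, (0.4) p.253] -/
theorem sect2Slot_gaussBare_one_pos_ae_of_measurable_bg (hN : 2 ≤ N) {ν : Stage7Numerics} (A₁ : ℝ) {M : ℕ} {g : ℕ → ℝ} (Sg : Sect2.Setting 𝔸 (SU N))
    (Rz : Sect2.Residual (F.P p.K) 𝔸) (s : SeqOfRecord F ν M g p.K 1) (hδ : 0 < deltaOfRecord ν g 0 A₁) (E' : ℝ) {U : BgMap F N p.K} (hU : Measurable U) :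
    ∀ᵐ V1 ∂fieldMeasure (F.P p.K) 1 (SU N),
      0 < sect2Slot F N (FluctV N) p.K Sg Rz
        (⟨fun _ _ _ => 1, fun j Λ' ω => ∑ b ∈ (Set.toFinite (bondsIn j (Λ'ᶜ ∩ s.Ω (j + 1)))).toFinset, ‖(ω j).2 b‖ ^ 2,
          chiAW F N (FluctV N) ν A₁ p g⟩ : TkWeights F N (FluctV N) p.K) s (Sect2.TermValues.zero : Sect2.TermValues (F.P p.K) 𝔸 (FluctV N) M) E' U V1 :=
  sect2Slot_gaussBare_one_pos_ae ν A₁ M p g hN Sg Rz s hδ E' U (measurable_sect2Operand_zero p Sg Rz s E' hU) (sect2Operand_zero_le p Sg Rz s E' U)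

end OperandRowsOfRecord

/-! ## §4  AT THE RECORD: L's off-top support hypothesis `hsupp` (✓p735871) at `k = 0` is a THEOREM, no row left -/

section AtRecord

/-- ★★★★ **THE `k = 0` CLAUSE OF THE LOCATED SENTENCE'S OFF-TOP SUPPORT HYPOTHESIS IS A THEOREM — NO ROW LEFT** (def-R's background map `UbgOfRecord₁₃CoP … P 1 s` is
measurable by this seat's `…N11BackgroundCoPMeasurable.measurable_UbgOfRecord₁₃CoP`; the zero-term operand is bounded by §3).  For every `θ`, run `P`, constants `e`, `N ≥ 2`,
`δ_0 > 0` (automatic along an admissible run in a window `γ < 1`: L §0) and EVERY new sequence `s` of length `1` (the clause `Ω₁(s) ≠ 𝕋` of `hsupp` is not even needed): a.e. in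
`V₁` — in particular a.e. on the `χ₁(s)`-support where `ρ₁(s)(V₁) > 0` — the Gaussian-bare §2-form slot `I^G_P(s)(V₁)` is `> 0`.  This is verbatim the `k = 0` instance of the hypothesis `hsupp` of L's
`k1_consequent_of_residualBlind_remainder_of_offTop_gaussSupports`; the generations `k ≥ 1` need the same argument through the nested generations ((R3), not typed here).
LOCATED, count-neutral; nothing of Bałaban asserted; no K1⁹ witness. [cite: Balaban1988Convergent, (2.18) p.257, (2.20)–(2.23) p.258, (3.23)–(3.25) p.270; Balaban1989LargeFieldII, Thm 1 p.355 (bookkeeping)] -/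
theorem offTop_gaussSupports_firstStep (θ : Stage13HParams F N) (hN : 2 ≤ N) (e : B12.RunParams → ℝ) (P : B12.RunParams)
    (hδ : 0 < deltaOfRecord θ.ν (gOfRecord₁₃ F N θ.toStage13Params P) 0 θ.A₁)
    (s : SeqOfRecord F θ.ν θ.τ9.M (gOfRecord₁₃ F N θ.toStage13Params P) P.K (0 + 1)) :
    ∀ᵐ V ∂fieldMeasure (F.P P.K) (0 + 1) (SU N), chiSeqOfRecord F N θ.ν θ.τ9.M (gOfRecord₁₃ F N θ.toStage13Params P) P.K (0 + 1) s V ≠ 0 →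
      0 < slotsOfRecord F N θ.ν θ.τ9 (EOfRecord₁₃ F N θ.toStage13Params) (wOfRecord₉ F N θ.toStage9Params) θ.ppSel P (gOfRecord₁₃ F N θ.toStage13Params P) (0 + 1) s V →
      0 < sect2Slot F N (FluctV N) P.K (settingOfRecord₁₃ F N θ.toStage13Params P) (θ.Rz P.K)
        (⟨fun _ _ _ => 1, fun j Λ' ω => ∑ b ∈ (Set.toFinite (bondsIn j (Λ'ᶜ ∩ s.Ω (j + 1)))).toFinset, ‖(ω j).2 b‖ ^ 2,
          chiAW F N (FluctV N) θ.ν θ.A₁ P (gOfRecord₁₃ F N θ.toStage13Params P)⟩ : TkWeights F N (FluctV N) P.K)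
        s Sect2.TermValues.zero (e P) (UbgOfRecord₁₃CoP F N θ.toStage13Params P (0 + 1) s) V := by
  filter_upwards [sect2Slot_gaussBare_one_pos_ae_of_measurable_bg P hN θ.A₁ (settingOfRecord₁₃ F N θ.toStage13Params P) (θ.Rz P.K) s hδ (e P)
    (BalabanUVNodesN11BackgroundCoPMeasurable.measurable_UbgOfRecord₁₃CoP F N θ.toStage13Params P (0 + 1) s)] with V hV _ _
  exact hV

end AtRecord

end Summit.QuantumFields.YangMills.Theorems.BalabanUVNodesN11K1SupportsOffTopFirstStep

end
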